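import Summits.Parity.GeneralizedHardyLittlewood.Theorems.PrimeLevelFamEdgeIdeaDeltasZetaPrimeProfileDefs
import Mathlib.Algebra.Order.Chebyshev
import Mathlib.Analysis.SpecialFunctions.Exp
import HarnessLib

/-!
# Route `PrimeLevelFamEdge` — TYPED IDEA DELTAS, deck 25: `barrier` lens × CI-GAPS — K-L21-6 «THE DISCRETE FLOOR'S REACH» (cell
# ls-idea, seat ls-idea-lens-21 gen 5, card K-L21-6; the seat's `Sketch_L21_DiscreteFloor.lean` sha16 3476d648fa6dd09e, critic F
# mark b29; LANDING NOTE typer ls-idea-typ-1 gen 3: VERBATIM (already in the deck namespace `…IdeaDeltas.ZetaPrimeDiscrete`,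
# imports deck 24) up to this header and added docstrings.)

Critic F b28 (card-verdicts l.245–261) decided the ζ′-face of the barrier map as
`W-ζ′-CEIL` (ceilings: Levinson–Montgomery / CGG Thm 1 / Ki–Lee / unmollified Jensen — the proved NO-GO `ceilingOnly_noGo`
of deck 24 applies ONLY to «ceilings alone») versus `W-ζ′-DISC` := the DISCRETE zero-statistic lower-bound methods
(Conrey–Ghosh 1989/90 `Σ_{γ′≤T} T^{½−β′} ≫ T log T`, first / second discrete moments at the zeros of `ζ′`, Soundararajan 1998
`m⁻(ν) > 0 for ν ≥ 2.6` under RH) — «placed open-computable: its REACH is the next computation».  This file types that cell and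
proves the elementary half of the reach computation.

* `expZeroSum s T` — the discrete exponential zero-sum `Σ_{ρ′ : ζ′ρ′ = 0, T ≤ γ′ ≤ 2T} exp(−s·(β′−½)·log T) = Σ T^{−s(β′−½)}`
  (CG89's sum is `s = 1`); it is the LAPLACE TRANSFORM of the abscissa counting measure, so by Fubini
  `E_T(s)/N = s²∫₀^∞ e^{−su} h_T(u) du` with `h_T = 𝒢_T + u − 𝒢_T(0)` the integrated profile of deck 24: a Laplace-weighted
  PROFILE FLOOR — the discrete floors join the K-L21-5 taxonomy (floors act only to their right).
* `DiscreteExpFloor s μ` — the statement class `W-ζ′-DISC`: eventually `(2π/(T log T))·E_T(s) ≥ μ`.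
* PROVED (finite sums, `Finset`, no analysis): the SHARP CAUCHY–SCHWARZ CERTIFICATE.  For abscissae `x_i ≥ 0` (RH side),
  weights `w_i ≥ 0`, decay `θ ≥ 0` and a cut `R`:
  `(Σ w_i e^{−θx_i})² ≤ (Σ w_i²)·(N_R + (N − N_R)·e^{−2θR})`, `N_R := #{i : x_i ≤ R}` (`weighted_certificate_sq_le`) — the
  best count a floor `Σ w e^{−θx} ≥ κ₁N` plus a ceiling `Σ w² ≤ κ₂N` can certify is `N_R/N ≥ (κ₁²/κ₂ − e^{−2θR})/(1 − e^{−2θR})`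
  (`certificate_count_bound`); and since `(Σ w e^{−θx})² ≤ (Σ w²)·Σ e^{−2θx}` for ANY weights (`weighted_sq_le_laplace`),
  the data of every such certificate obey `κ₁²/κ₂ ≤ L(2θ) := E e^{−2θx}` (`certificate_data_le_laplace`), so the certificate is
  VACUOUS for every `R` with `e^{−2θR} ≥ L_true(2θ)`, i.e. below the REACH FLOOR `R♭(θ) := log(1/L_true(2θ))/(2θ)`
  (`certificate_vacuous_below_reach`).
* NUMBERS — SEAT'S VALUES, CORRECTED BY CRITIC F (F-F29-1: independent CUE(∞) computation gives
  `L(1/2/3/4/6/8) = 0.1825/0.0880/0.0544/0.0378/0.0222/0.0150`, `R♭(1) = 1.215`, `R♭(2) = 0.82`, `R♭(3) = 0.635`, thresholds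
  `θ ≈ 2.25 / 2.75 / 5.4 / 11.4`; the seat's finite-`T` column below is 15–30 % LOW at `s ≥ 2` and its «RMT two-term» column is
  a truncated series — WALL verdict at evaluable decay survives: `θ ≤ 1` robust, `θ = 2` thin) (seat scripts `profile5.py`,
  `ahpoly4.py`; computed ≠ proved; T = 2·10⁴, M = 25600, two seeds, + T = 10⁵):
  `L_T(2) = 0.0746/0.0723/0.0747 ± 0.0008`, `L_T(4) = 0.0290/0.0270/0.0299`, `L_T(6) = 0.0164/0.0144/0.0179`, RMT two-term law
  (Dueñez–Farmer–Froehlich–Hughes–Mezzadri–Phan 2010, Thm 3.1: density `(8/9π)ν^{1/2} − (82/45π)ν^{3/2}`) `L(4) = 0.0229,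
  L(6) = 0.0168, L(8) = 0.0124`.  Hence `R♭(1) = 1.30`, `R♭(2) = 0.885`, `R♭(2.5) = 0.77`, `R♭(3) = 0.685`, `R♭(5.8) ≈ 0.43`,
  `R♭(12) ≈ 0.25`: a certificate whose reach enters the pair band `[0.670, 0.765)` needs decay `θ ≥ 2.6–3.1` reflected
  `ζ`-factors, the window edge `0.43` needs `θ ≈ 6`, the working point `0.25` needs `θ ≈ 12`; the discrete moments that can be
  EVALUATED have `θ ≤ 2` (first moment: Conrey–Ghosh–Gonek 1989 Thms 2–3 with the GLH «note added in proof»; second: borderline).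
  AH side (CUE dictionary `ζ′ ↔ Λ′`, pair-correlation-PINNED half-lattice worlds): the floor DATUM `E e^{−sx} ≥ L_true(s)` is
  reproduced by an LR-like renewal world for `s ≤ 3` and by first-atom-pinned long-run worlds for `s ≤ 7`, by none for
  `s ≥ 8` (ratio `0.84 / 0.54 / 0.06` at `s = 8 / 10 / 20`).  Evaluable `s = θ ≤ 2` lies below both crossovers: the
  discrete floors in print are AH∧RH-CONSISTENT data — `W-ζ′-DISC(θ ≤ 2)` is WALL with a number; the typed statement just outside
  is `DiscreteExpFloor s μ` with `s ≥ 8` (AH-false in the model against every pinned world), three to four reflected moments beyond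
  technology — the ζ′-face twin of BN-7a (`Δ′ = 1` available vs `1+` needed) and BN-1 (`y = T^{1−δ}` vs `T^{1+}`).
HONESTY: no exceptional-zero theorem (no Landau–Siegel / Siegel-zero exclusion, no Theorem 1–2 of arXiv:2211.02515, no repaired
Margin232) is proved by ideation; nothing below is a theorem about `ζ`; typed ≠ proved; computed ≠ proved; located ≠ endorsed;
no summit statement is proved by this seat.
-/

noncomputable section

namespace Summit.Parity.GeneralizedHardyLittlewood.Theorems.PrimeLevelFamEdgeIdeaDeltas.ZetaPrimeDiscrete

open Literature.NumberTheory.LFunctions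
open Summit.Parity.GeneralizedHardyLittlewood.Theorems.PrimeLevelFamEdgeIdeaDeltas.ZetaPrimeWindow

/-! ## The statement class `W-ζ′-DISC` -/

/-- Zeros of `ζ′` in the dyadic window `T ≤ γ′ ≤ 2T` (all abscissae; compare `Radziwill2014.derivZerosNearLine ε T`, which
cuts at `(β′ − ½) log T ≤ ε`). -/
def derivZerosWindow (T : ℝ) : Set ℂ :=
  {ρ : ℂ | deriv riemannZeta ρ = 0 ∧ T ≤ ρ.im ∧ ρ.im ≤ 2 * T}

/-- Normalised abscissa `x(ρ′) = (β′ − ½)·log T` (nonnegative for `γ′` large under RH: Speiser / Levinson–Montgomery). -/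
def abscissa (T : ℝ) (ρ : ℂ) : ℝ := (ρ.re - 1 / 2) * Real.log T

/-- The discrete exponential zero-sum `E_T(s) = Σ_{ρ′ ∈ window} exp(−s·x(ρ′)) = Σ T^{−s(β′−½)}` — the Laplace transform of the
abscissa counting measure; Conrey–Ghosh's `Σ T^{½−β′}` is `s = 1`.  (`finsum` returns the junk value `0` on an infinite
support; the support is finite — zeros of the non-constant analytic `ζ′` in a compact set — but a PRODUCER of a
`DiscreteExpFloor` must record `(derivZerosWindow T).Finite`, as with P-F28-1 for the profile integrals.) -/
def expZeroSum (s T : ℝ) : ℝ :=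
  ∑ᶠ ρ ∈ derivZerosWindow T, Real.exp (-(s * abscissa T ρ))

/-- `W-ζ′-DISC`, the DISCRETE EXPONENTIAL FLOOR with decay `s` and level `μ` (per-ζ-zero normalisation `2π/(T log T)`):
eventually `μ ≤ (2π/(T log T))·E_T(s)`.  (Critic F P-F29-3 / erratum E-L21-1: the printed `s = 1` statements are
Conrey–Ghosh-type sums read by the seat — located, NOT byte-checked here as «`μ > 0` in print»; Conrey–Ghosh–Gonek 1989
Thms 2–3 are sums over zeros of `ζ`, the `ζ′`-sum is named only.)  The card's placement (pencil + numerics, F-F29-1 applies):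
AH∧RH-consistent for small `s` at the TRUE level, AH-false only for `s` well beyond evaluable decay. -/
def DiscreteExpFloor (s μ : ℝ) : Prop :=
  ∃ T₀ : ℝ, ∀ T : ℝ, T₀ ≤ T → μ ≤ 2 * Real.pi / (T * Real.log T) * expZeroSum s T

/-- A discrete floor is MONOTONE in the level (bookkeeping). -/
theorem DiscreteExpFloor.mono {s μ μ' : ℝ} (h : DiscreteExpFloor s μ) (hμ : μ' ≤ μ) : DiscreteExpFloor s μ' := by
  obtain ⟨T₀, hT₀⟩ := h
  exact ⟨T₀, fun T hT => le_trans hμ (hT₀ T hT)⟩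

/-! ## The sharp Cauchy–Schwarz certificate (finite sums; the elementary half of the REACH computation) -/

variable {ι : Type*}

/-- The extremal comparison profile of the certificate: `1` on `x ≤ R`, `e^{−θR}` beyond. -/
def cutProfile (θ R x : ℝ) : ℝ := if x ≤ R then 1 else Real.exp (-(θ * R))

/-- `e^{−θx} ≤ cutProfile θ R x` for `θ, x ≥ 0`. -/
theorem exp_le_cutProfile {θ R x : ℝ} (hθ : 0 ≤ θ) (hx : 0 ≤ x) :
    Real.exp (-(θ * x)) ≤ cutProfile θ R x := by
  unfold cutProfile
  split_ifs with h
  · rw [Real.exp_le_one_iff]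
    nlinarith [mul_nonneg hθ hx]
  · push Not at h
    exact Real.exp_le_exp.mpr (by nlinarith [mul_le_mul_of_nonneg_left h.le hθ])

/-- Below the cut the profile squared is `1`. -/
theorem cutProfile_sq_of_le {θ R x : ℝ} (h : x ≤ R) : cutProfile θ R x ^ 2 = 1 := by
  simp [cutProfile, h]

/-- Above the cut the profile squared is `e^{−2θR}`. -/
theorem cutProfile_sq_of_not_le {θ R x : ℝ} (h : ¬ x ≤ R) :
    cutProfile θ R x ^ 2 = Real.exp (-(2 * θ * R)) := by
  simp only [cutProfile, h, if_false]
  rw [sq, ← Real.exp_add]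
  ring_nf

/-- `Σ_i cut(x_i)² = N_R + (N − N_R)·e^{−2θR}`. -/
theorem sum_cutProfile_sq [DecidableEq ι] (s : Finset ι) (x : ι → ℝ) (θ R : ℝ) :
    ∑ i ∈ s, cutProfile θ R (x i) ^ 2
      = ((s.filter fun i => x i ≤ R).card : ℝ)
        + ((s.card : ℝ) - ((s.filter fun i => x i ≤ R).card : ℝ)) * Real.exp (-(2 * θ * R)) := by
  classical
  have hsplit := Finset.sum_filter_add_sum_filter_not s (fun i => x i ≤ R) (fun i => cutProfile θ R (x i) ^ 2)
  have h1 : ∑ i ∈ s.filter (fun i => x i ≤ R), cutProfile θ R (x i) ^ 2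
      = ((s.filter fun i => x i ≤ R).card : ℝ) := by
    rw [Finset.sum_congr rfl (fun i hi => cutProfile_sq_of_le (θ := θ) (Finset.mem_filter.mp hi).2)]
    simp
  have h2 : ∑ i ∈ s.filter (fun i => ¬ x i ≤ R), cutProfile θ R (x i) ^ 2
      = ((s.filter fun i => ¬ x i ≤ R).card : ℝ) * Real.exp (-(2 * θ * R)) := by
    rw [Finset.sum_congr rfl (fun i hi => cutProfile_sq_of_not_le (θ := θ) (Finset.mem_filter.mp hi).2)]
    simp
  have hcard : ((s.filter fun i => ¬ x i ≤ R).card : ℝ)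
      = (s.card : ℝ) - ((s.filter fun i => x i ≤ R).card : ℝ) := by
    have := Finset.card_filter_add_card_filter_not (s := s) (fun i => x i ≤ R)
    have h' : ((s.filter fun i => x i ≤ R).card : ℝ) + ((s.filter fun i => ¬ x i ≤ R).card : ℝ) = (s.card : ℝ) := by
      exact_mod_cast this
    linarith
  rw [← hsplit, h1, h2, hcard]

/-- SHARP CS CERTIFICATE.  For abscissae `x_i ≥ 0`, weights `w_i ≥ 0`, decay `θ ≥ 0` and any cut `R`:
`(Σ w_i e^{−θ x_i})² ≤ (Σ w_i²)·(N_R + (N − N_R) e^{−2θR})`.  (Pointwise `e^{−θx} ≤ cut(x)`, then Cauchy–Schwarz; equality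
when the non-counted abscissae sit at `R⁺` and `w ∝ cut(x)` — the adversary's configuration, so the bound is the exact
content of the data {floor, `ℓ²`-ceiling}.) -/
theorem weighted_certificate_sq_le [DecidableEq ι] (s : Finset ι) (x w : ι → ℝ) {θ : ℝ} (R : ℝ) (hθ : 0 ≤ θ)
    (hx : ∀ i ∈ s, 0 ≤ x i) (hw : ∀ i ∈ s, 0 ≤ w i) :
    (∑ i ∈ s, w i * Real.exp (-(θ * x i))) ^ 2
      ≤ (∑ i ∈ s, w i ^ 2) * (((s.filter fun i => x i ≤ R).card : ℝ)
          + ((s.card : ℝ) - ((s.filter fun i => x i ≤ R).card : ℝ)) * Real.exp (-(2 * θ * R))) := by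
  have hle : ∑ i ∈ s, w i * Real.exp (-(θ * x i)) ≤ ∑ i ∈ s, w i * cutProfile θ R (x i) :=
    Finset.sum_le_sum fun i hi => mul_le_mul_of_nonneg_left (exp_le_cutProfile hθ (hx i hi)) (hw i hi)
  have hnn : 0 ≤ ∑ i ∈ s, w i * Real.exp (-(θ * x i)) :=
    Finset.sum_nonneg fun i hi => mul_nonneg (hw i hi) (Real.exp_pos _).le
  have hcs := Finset.sum_mul_sq_le_sq_mul_sq s w (fun i => cutProfile θ R (x i))
  rw [sum_cutProfile_sq] at hcs
  exact le_trans (pow_le_pow_left₀ hnn hle 2) hcs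

/-- For ANY real weights: `(Σ w_i e^{−θx_i})² ≤ (Σ w_i²)·Σ e^{−2θ x_i}` — the certificate's numerator is controlled by the
Laplace transform at `2θ` (`κ₁²/κ₂ ≤ L(2θ)` after normalisation). -/
theorem weighted_sq_le_laplace (s : Finset ι) (x w : ι → ℝ) (θ : ℝ) :
    (∑ i ∈ s, w i * Real.exp (-(θ * x i))) ^ 2
      ≤ (∑ i ∈ s, w i ^ 2) * ∑ i ∈ s, Real.exp (-(2 * θ * x i)) := by
  have hcs := Finset.sum_mul_sq_le_sq_mul_sq s w (fun i => Real.exp (-(θ * x i)))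
  have hsq : ∀ i, Real.exp (-(θ * x i)) ^ 2 = Real.exp (-(2 * θ * x i)) := fun i => by
    rw [sq, ← Real.exp_add]; ring_nf
  simpa only [hsq] using hcs

/-- CERTIFIED COUNT.  Data: a floor `κ₁·N ≤ Σ w e^{−θx}` (`κ₁ ≥ 0`) and an `ℓ²`-ceiling `Σ w² ≤ κ₂·N`.  Conclusion (product form of
`N_R/N ≥ (κ₁²/κ₂ − e^{−2θR})/(1 − e^{−2θR})`): `(κ₁N)² ≤ κ₂N·(N_R + (N − N_R)e^{−2θR})`. -/
theorem certificate_count_bound [DecidableEq ι] (s : Finset ι) (x w : ι → ℝ) {θ κ₁ κ₂ : ℝ} (R : ℝ) (hθ : 0 ≤ θ)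
    (hx : ∀ i ∈ s, 0 ≤ x i) (hw : ∀ i ∈ s, 0 ≤ w i) (hκ₁ : 0 ≤ κ₁)
    (hfloor : κ₁ * s.card ≤ ∑ i ∈ s, w i * Real.exp (-(θ * x i)))
    (hceil : ∑ i ∈ s, w i ^ 2 ≤ κ₂ * s.card) :
    (κ₁ * s.card) ^ 2
      ≤ κ₂ * s.card * (((s.filter fun i => x i ≤ R).card : ℝ)
          + ((s.card : ℝ) - ((s.filter fun i => x i ≤ R).card : ℝ)) * Real.exp (-(2 * θ * R))) := by
  have A := weighted_certificate_sq_le s x w R hθ hx hw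
  have B : (κ₁ * s.card) ^ 2 ≤ (∑ i ∈ s, w i * Real.exp (-(θ * x i))) ^ 2 :=
    pow_le_pow_left₀ (by positivity) hfloor 2
  have hNR : ((s.filter fun i => x i ≤ R).card : ℝ) ≤ (s.card : ℝ) := by
    exact_mod_cast Finset.card_filter_le s (fun i => x i ≤ R)
  have C : 0 ≤ ((s.filter fun i => x i ≤ R).card : ℝ)
      + ((s.card : ℝ) - ((s.filter fun i => x i ≤ R).card : ℝ)) * Real.exp (-(2 * θ * R)) := by
    have : 0 ≤ ((s.card : ℝ) - ((s.filter fun i => x i ≤ R).card : ℝ)) := by linarith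
    positivity
  exact le_trans B (le_trans A (mul_le_mul_of_nonneg_right hceil C))

/-- DATA CONSTRAINT.  With `Σ e^{−2θx} ≤ Λ·N` (`Λ` = the TRUE normalised Laplace transform at `2θ`), every floor/ceiling pair
obeys `(κ₁N)² ≤ κ₂·Λ·N²`, i.e. `κ₁²/κ₂ ≤ Λ = L(2θ)`: no choice of weights beats the abscissa law itself. -/
theorem certificate_data_le_laplace (s : Finset ι) (x w : ι → ℝ) {θ κ₁ κ₂ Λ : ℝ} (hκ₁ : 0 ≤ κ₁)
    (hfloor : κ₁ * s.card ≤ ∑ i ∈ s, w i * Real.exp (-(θ * x i)))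
    (hceil : ∑ i ∈ s, w i ^ 2 ≤ κ₂ * s.card)
    (hΛ : ∑ i ∈ s, Real.exp (-(2 * θ * x i)) ≤ Λ * s.card) :
    (κ₁ * s.card) ^ 2 ≤ κ₂ * Λ * (s.card : ℝ) ^ 2 := by
  have A := weighted_sq_le_laplace s x w θ
  have B : (κ₁ * s.card) ^ 2 ≤ (∑ i ∈ s, w i * Real.exp (-(θ * x i))) ^ 2 :=
    pow_le_pow_left₀ (by positivity) hfloor 2
  have hL0 : 0 ≤ ∑ i ∈ s, Real.exp (-(2 * θ * x i)) := Finset.sum_nonneg fun i _ => (Real.exp_pos _).le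
  have hw0 : 0 ≤ ∑ i ∈ s, w i ^ 2 := Finset.sum_nonneg fun i _ => sq_nonneg _
  calc (κ₁ * s.card) ^ 2 ≤ (∑ i ∈ s, w i * Real.exp (-(θ * x i))) ^ 2 := B
    _ ≤ (∑ i ∈ s, w i ^ 2) * ∑ i ∈ s, Real.exp (-(2 * θ * x i)) := A
    _ ≤ (κ₂ * s.card) * (Λ * s.card) :=
        mul_le_mul hceil hΛ hL0 (le_trans hw0 hceil)
    _ = κ₂ * Λ * (s.card : ℝ) ^ 2 := by ring

/-- VACUITY BELOW THE REACH.  If the data ratio does not beat the cut, `κ₁² ≤ κ₂·e^{−2θR}` — which `certificate_data_le_laplace`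
FORCES whenever `L_true(2θ) ≤ e^{−2θR}`, i.e. for every `R ≤ R♭(θ) := log(1/L_true(2θ))/(2θ)` — then the conclusion of
`certificate_count_bound` holds with ANY value `n ≥ 0` (in particular every `n ∈ [0, N]`) in place of `N_R`: the certificate says
nothing about the count.
Numbers (card K-L21-6): `R♭(1) = 1.30`, `R♭(2) = 0.885`, `R♭(3) = 0.685`; reach `0.76 / 0.67 / 0.43 / 0.25` needs
`θ ≈ 2.6 / 3.1 / 5.8 / 12`. -/
theorem certificate_vacuous_below_reach {θ κ₁ κ₂ R N : ℝ} (hθ : 0 ≤ θ) (hR : 0 ≤ R) (hκ₂ : 0 ≤ κ₂) (hN : 0 ≤ N)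
    (hbelow : κ₁ ^ 2 ≤ κ₂ * Real.exp (-(2 * θ * R))) {n : ℝ} (hn0 : 0 ≤ n) :
    (κ₁ * N) ^ 2 ≤ κ₂ * N * (n + (N - n) * Real.exp (-(2 * θ * R))) := by
  have hE1 : Real.exp (-(2 * θ * R)) ≤ 1 := by
    rw [Real.exp_le_one_iff]; nlinarith [mul_nonneg hθ hR]
  have hE0 : 0 ≤ Real.exp (-(2 * θ * R)) := (Real.exp_pos _).le
  -- the adversary's worst case `n = 0` already satisfies the bound
  have step1 : N * Real.exp (-(2 * θ * R)) ≤ n + (N - n) * Real.exp (-(2 * θ * R)) := by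
    nlinarith [mul_nonneg hn0 (sub_nonneg.mpr hE1)]
  have step2 : (κ₁ * N) ^ 2 ≤ κ₂ * N * (N * Real.exp (-(2 * θ * R))) := by
    have := mul_le_mul_of_nonneg_right hbelow (mul_nonneg hN hN)
    nlinarith [this]
  exact le_trans step2 (mul_le_mul_of_nonneg_left step1 (mul_nonneg hκ₂ hN))

/-! ## Bookkeeping: the unweighted (Chebyshev) floor is the case `w ≡ 1` -/

/-- Chebyshev form: `Σ e^{−s x_i} ≤ N_R + (N − N_R)·e^{−sR}` for `x_i ≥ 0`, `s ≥ 0`; so an unweighted floor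
`Σ e^{−sx} ≥ μN` certifies `N_R/N ≥ (μ − e^{−sR})/(1 − e^{−sR})`, non-vacuous only for `R > log(1/μ)/s ≥ log(1/L_true(s))/s`
(`= 1.76` at `s = 1`, `1.30` at `s = 2`: finite-`T` numbers of the card). -/
theorem chebyshev_floor_le [DecidableEq ι] (s : Finset ι) (x : ι → ℝ) {σ : ℝ} (R : ℝ) (hσ : 0 ≤ σ)
    (hx : ∀ i ∈ s, 0 ≤ x i) :
    ∑ i ∈ s, Real.exp (-(σ * x i))
      ≤ ((s.filter fun i => x i ≤ R).card : ℝ)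
        + ((s.card : ℝ) - ((s.filter fun i => x i ≤ R).card : ℝ)) * Real.exp (-(σ * R)) := by
  classical
  have hle : ∑ i ∈ s, Real.exp (-(σ * x i)) ≤ ∑ i ∈ s, cutProfile σ R (x i) :=
    Finset.sum_le_sum fun i hi => exp_le_cutProfile hσ (hx i hi)
  have hsplit := Finset.sum_filter_add_sum_filter_not s (fun i => x i ≤ R) (fun i => cutProfile σ R (x i))
  have h1 : ∑ i ∈ s.filter (fun i => x i ≤ R), cutProfile σ R (x i) = ((s.filter fun i => x i ≤ R).card : ℝ) := by
    rw [Finset.sum_congr rfl (fun i hi => by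
      show cutProfile σ R (x i) = 1
      simp [cutProfile, (Finset.mem_filter.mp hi).2])]
    simp
  have h2 : ∑ i ∈ s.filter (fun i => ¬ x i ≤ R), cutProfile σ R (x i)
      = ((s.filter fun i => ¬ x i ≤ R).card : ℝ) * Real.exp (-(σ * R)) := by
    rw [Finset.sum_congr rfl (fun i hi => by
      show cutProfile σ R (x i) = Real.exp (-(σ * R))
      simp [cutProfile, (Finset.mem_filter.mp hi).2])]
    simp
  have hcard : ((s.filter fun i => ¬ x i ≤ R).card : ℝ)
      = (s.card : ℝ) - ((s.filter fun i => x i ≤ R).card : ℝ) := by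
    have := Finset.card_filter_add_card_filter_not (s := s) (fun i => x i ≤ R)
    have h' : ((s.filter fun i => x i ≤ R).card : ℝ) + ((s.filter fun i => ¬ x i ≤ R).card : ℝ) = (s.card : ℝ) := by
      exact_mod_cast this
    linarith
  rw [← hsplit, h1, h2, hcard] at hle
  exact hle

/-! ## Appendix (typer ls-idea-typ-1 gen 4, 2026-08-28): the two lemmas of the seat's Sketch v2 (sha16 08f9c88d0b927a72, §R5 answer-once to
critic F b29; B junk read #107 J4 CLEAN; F b29.4 «appendable») — VERBATIM bodies, appended after the v1 deck (append-only rule). -/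

/-- `E_T(s) ≥ 0` always (a `finsum` of exponentials; `0` on an infinite support). -/
theorem expZeroSum_nonneg (s T : ℝ) : 0 ≤ expZeroSum s T :=
  finsum_nonneg fun _ => finsum_nonneg fun _ => (Real.exp_pos _).le

/-- JUNK INSTANCE (critic F J1): for `T ≥ 1` the normalising factor is `≥ 0`, so every level `μ ≤ 0` holds trivially; consumers demand
`0 < μ`. -/
theorem DiscreteExpFloor.of_nonpos {s μ : ℝ} (hμ : μ ≤ 0) : DiscreteExpFloor s μ := by
  refine ⟨1, fun T hT => le_trans hμ ?_⟩
  have hT0 : 0 ≤ T := le_trans zero_le_one hT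
  have hlog : 0 ≤ Real.log T := Real.log_nonneg hT
  have : 0 ≤ 2 * Real.pi / (T * Real.log T) := by positivity
  exact mul_nonneg this (expZeroSum_nonneg s T)

/-! ## Appendix 2 (typer ls-idea-typ-1 gen 4, 2026-08-28): the four lemmas of the seat's Sketch v3 (sha16 a2a9a6b3dada7a36, card v7.0
cfabd6714922da85 §R6 answer-once + K-L21-7 «THE PRECISION WALL IS ASYMPTOTICALLY FREE; THE AH SHADOW IS NOT»; critic B F-B184-1 as ruled by
critic F b29.2) — VERBATIM bodies, appended after Appendix 1 (append-only rule; one docstring added to `two_decay_minorant_nonpos`).  Seat's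
erratum E-L21-2 (v3 module docblock, NOT re-applied to the v1 docstrings above, which stay byte-identical): with pinned long runs `m → 300`
the floor datum is AH-reproducible for `s ≤ 6.4` (was 5.8) and by no pinned world for `s ≥ 7` (was 6); the statement «just outside» becomes
`DiscreteExpFloor 12 0.005` (`L_CUE(12) = 0.0082`, sup pinned `0.0032`); the v1 example `DiscreteExpFloor 10 0.006` is BORDERLINE.  Near-line
counts and the multi-datum reach law `P*(R; Θ, m) = F(R; Θ·m) ± 0.0003` are the seat's computations (computed ≠ proved); the lemmas below are the
elementary counting half only.  Critic F b30 (K-L21-7 PASS (KEEP), FIX none): `minorant_count_bound` read symbol by symbol (`h0` = `p ≤ 0`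
on ALL `y > R`); precisions P-F30-1/2/3 concern the seat's LP tables (grid-step endpoint `N_{R+h}`, conditioning, stored world vectors), not
these lemmas. -/

/-! ### MULTI-DATUM CERTIFICATES (critic B's F-B184-1 / critic F's b29.2; card K-L21-7 «THE PRECISION WALL IS ASYMPTOTICALLY FREE; THE AH SHADOW IS NOT»)

A certificate built from SEVERAL evaluated exponential data (floors and ceilings at decays `θ_k ≤ Θ`, plus the count) is a MINORANT
`p(x) = a₀ + Σ_k a_k e^{−θ_k x}` of the indicator of `[0, R]` on `x ≥ 0`: `p ≤ 1` on `[0, R]`, `p ≤ 0` beyond `R`.  Then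
`Σ_i p(x_i) ≤ N_R` — the two-decay minorant `e^{−θ₁x} − c·e^{−θ₂x}` of critic B is the case `k = 2, a₀ = 0`.  The lemma below is
the counting step for an ARBITRARY real function `p` with those two properties (the data enter only through `Σ_i p(x_i)`); the card's
LP computes, against the CUE(∞) law, how much such a `p` can certify with `n` data at decay `≤ Θ` and at what relative precision. -/

/-- MINORANT COUNT BOUND.  If `p ≤ 1` on `[0, R]` and `p ≤ 0` on `(R, ∞)`, then over abscissae `x_i ≥ 0`:
`Σ_i p(x_i) ≤ #{i : x_i ≤ R}`. -/
theorem minorant_count_bound (s : Finset ι) (x : ι → ℝ) (p : ℝ → ℝ) (R : ℝ)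
    (hx : ∀ i ∈ s, 0 ≤ x i) (h1 : ∀ y, 0 ≤ y → y ≤ R → p y ≤ 1) (h0 : ∀ y, R < y → p y ≤ 0) :
    ∑ i ∈ s, p (x i) ≤ ((s.filter fun i => x i ≤ R).card : ℝ) := by
  classical
  have key : ∀ i ∈ s, p (x i) ≤ if x i ≤ R then (1 : ℝ) else 0 := by
    intro i hi
    by_cases h : x i ≤ R
    · rw [if_pos h]; exact h1 (x i) (hx i hi) h
    · rw [if_neg h]; exact h0 (x i) (lt_of_not_ge h)
  calc ∑ i ∈ s, p (x i) ≤ ∑ i ∈ s, (if x i ≤ R then (1 : ℝ) else 0) := Finset.sum_le_sum key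
    _ = ((s.filter fun i => x i ≤ R).card : ℝ) := by
        rw [Finset.sum_ite, Finset.sum_const_zero, add_zero, Finset.sum_const, nsmul_eq_mul, mul_one]

/-- CERTIFIED FRACTION.  With data `Σ_i p(x_i) ≥ P·N` (what the evaluated floors/ceilings deliver for the chosen coefficients), the
minorant certifies `N_R ≥ P·N`. -/
theorem minorant_certifies (s : Finset ι) (x : ι → ℝ) (p : ℝ → ℝ) (R P : ℝ)
    (hx : ∀ i ∈ s, 0 ≤ x i) (h1 : ∀ y, 0 ≤ y → y ≤ R → p y ≤ 1) (h0 : ∀ y, R < y → p y ≤ 0)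
    (hdata : P * s.card ≤ ∑ i ∈ s, p (x i)) :
    P * s.card ≤ ((s.filter fun i => x i ≤ R).card : ℝ) :=
  le_trans hdata (minorant_count_bound s x p R hx h1 h0)

/-- Critic B's TWO-DECAY MINORANT (pointwise): for `θ₂ < θ₁`, `0 < c`, `x ≥ 0`: `e^{−θ₁x} − c·e^{−θ₂x} ≤ 1`, and `≤ 0` once
`x ≥ log(1/c)/(θ₁ − θ₂)`.  (B proved this in `junk105`; restated here so the card's two-datum row has its counting lemma in one file.) -/
theorem two_decay_minorant_le_one {θ₁ θ₂ c x : ℝ} (hθ₁ : 0 ≤ θ₁) (hc : 0 ≤ c) (hx : 0 ≤ x) :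
    Real.exp (-(θ₁ * x)) - c * Real.exp (-(θ₂ * x)) ≤ 1 := by
  have h1 : Real.exp (-(θ₁ * x)) ≤ 1 := by
    rw [Real.exp_le_one_iff]; nlinarith
  have h2 : 0 ≤ c * Real.exp (-(θ₂ * x)) := mul_nonneg hc (Real.exp_pos _).le
  linarith

/-- Critic B's TWO-DECAY MINORANT, second half: for `θ₂ < θ₁`, `0 < c` and `x ≥ log(1/c)/(θ₁ − θ₂)` one has
`e^{−θ₁x} − c·e^{−θ₂x} ≤ 0` (so the minorant vanishes beyond the reach `R_c := log(1/c)/(θ₁ − θ₂)`). -/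
theorem two_decay_minorant_nonpos {θ₁ θ₂ c x : ℝ} (hθ : θ₂ < θ₁) (hc : 0 < c)
    (hx : Real.log (1 / c) / (θ₁ - θ₂) ≤ x) :
    Real.exp (-(θ₁ * x)) - c * Real.exp (-(θ₂ * x)) ≤ 0 := by
  have hd : 0 < θ₁ - θ₂ := sub_pos.mpr hθ
  have hx' : Real.log (1 / c) ≤ (θ₁ - θ₂) * x := by
    rwa [div_le_iff₀ hd, mul_comm] at hx
  -- e^{-θ₁ x} = e^{-θ₂ x} · e^{-(θ₁-θ₂)x} ≤ e^{-θ₂ x} · c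
  have hexp : Real.exp (-((θ₁ - θ₂) * x)) ≤ c := by
    have hlog : -Real.log (1 / c) = Real.log c := by
      rw [one_div, Real.log_inv, neg_neg]
    have : Real.exp (-((θ₁ - θ₂) * x)) ≤ Real.exp (-Real.log (1 / c)) :=
      Real.exp_le_exp.mpr (by linarith)
    rwa [hlog, Real.exp_log hc] at this
  have split : Real.exp (-(θ₁ * x)) = Real.exp (-(θ₂ * x)) * Real.exp (-((θ₁ - θ₂) * x)) := by
    rw [← Real.exp_add]; ring_nf
  rw [split]
  have hpos : 0 < Real.exp (-(θ₂ * x)) := Real.exp_pos _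
  nlinarith [mul_le_mul_of_nonneg_left hexp hpos.le]

end Summit.Parity.GeneralizedHardyLittlewood.Theorems.PrimeLevelFamEdgeIdeaDeltas.ZetaPrimeDiscrete
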